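import Summits.Ventures.PercRepro.C041TriDomAbsorbP
import Summits.Ventures.PercRepro.C041RelaxedTriJ
import Summits.Ventures.PercRepro.C041RelaxedTriJ2
import Summits.Ventures.PercRepro.C041RelaxedTriJ4
import Summits.Ventures.PercRepro.C041RelaxedTriJ5
import Summits.Ventures.PercRepro.C041RelaxedTriJ6
import Summits.Ventures.PercRepro.C041RelaxedTriJ8

/-!
# ROW C-041 — (P)-DOMINATION WITH THE EIGHT MIXED COMPLETIONS OF THE APART EXCESS (p6, gen 40; P6-TWOEXIT-LEAN.md §52
ADDENDUM 6; GENERATED by lean-drafts/p6/g40/genabs8.py)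

The eight maps `Q′ + (one manifest term of each exit)` of `C041RelaxedTriJ*` — `thetaTriJ = Q′ + ℓψ(w) w′ + w ℓψ(w′)`,
`thetaTriJ2 = Q′ + ℓψ(w) w′ + ℓψ(w ℓψ(w′))` and its exit swap, `thetaTriJ4 = Q′ + ℓψ(ℓψ(w) w′) + ℓψ(w ℓψ(w′))`,
`thetaTriJ5 = Q′ + n(w) ℓψ(w′) + n(w′) ℓψ(w)`, `thetaTriJ6 = Q′ + n(w) ℓψ(w′) + n(w′) w` and its swap, `thetaTriJ8 = Q′ + n(w) w′
+ n(w′) w` — are (P)-maps at cone inputs (`K4v_thetaTriJk_of_inCone`) and each carries ONE bare apart excess against one manifest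
atom of each exit (`BX + XB`, `BX + RWj`, `WRj + XB`, `WRj + RWj`, `WRa + RWa`, `WRa + XW`, `WX + RWa`, `WX + XW`).  THEOREM
((P)-ABSORBERS, MIXED COMPLETIONS) (`blockMap_ex2_eq_absorbQ`): with the cone absorbers `c, c₁, c₂, c₃, d`, the diamonds
`f₁, f₂` and the eight completions `q₁ … q₈` covered by fourteen count equations, `Θ = (absorbers) + e″ • Q′ + (manifest)`;
with `e″ = 0`: (P) and the ZONE O-CUBE at the host with ANY two cone zones (`K4v_blockMap_ex2_of_absorbQ`,
`zoneOCube_blockMap_ex2_of_absorbQ`) — 126 of the 246 six-vertex two-exit cores that are not triangle-dominated and the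
five-vertex core c5_13 satisfy the counts (own exact LP, lean-drafts/p6/g40/pdom5.py; with the twelve relaxed cores of
`C041TriDomAbsorbP5` as well: 161).
-/

namespace PercRepro

namespace ZoneZ

namespace MultiExit

open ZoneData Pendant Finset TwoExit TreeClosure RelaxedTriangle

variable {V₁ E₁ U₁ U₂ : Type} (Z₁ : ZoneData V₁ E₁ U₁ U₂) (u u' a₁ : V₁) [Fintype E₁] [DecidableEq E₁]

/-- **THEOREM ((P)-ABSORBERS, MIXED COMPLETIONS)**: the cone absorbers, the two diamonds, the eight mixed completions, `e″`
bare apart excesses and manifest maps. -/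
theorem blockMap_ex2_eq_absorbQ (c c₁ c₂ c₃ d f₁ f₂ q₁ q₂ q₃ q₄ q₅ q₆ q₇ q₈ s₁ s₂ s₃ s₄ s₅ s₆ s₀ s₇ s₈ s₉ s₁₀ s₁₁ s₁₂ E : ℕ)
    (h0 : tcount Z₁ u u' a₁ (false, true, false, true, false, true) =
      c + c₁ + c₂ + 2 * c₃ + d + 2 * f₁ + 2 * f₂ + q₁ + q₂ + q₃ + q₄ + q₅ + q₆ + q₇ + q₈ + E + tcount Z₁ u u' a₁ (false, true, true, false, false, false)
        + tcount Z₁ u u' a₁ (false, false, false, true, true, false)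
        + tcount Z₁ u u' a₁ (false, true, false, false, true, false))
    (h1 : tcount Z₁ u u' a₁ (false, true, false, true, true, true) = c + f₁ + 4 * f₂ + s₁)
    (h2 : tcount Z₁ u u' a₁ (false, true, true, false, false, false) = c₁ + c₂ + 2 * c₃ + 2 * f₁ + s₂)
    (h3 : tcount Z₁ u u' a₁ (false, false, false, true, true, false) = c₂ + 2 * f₂ + q₃ + q₄ + s₃)
    (h4 : tcount Z₁ u u' a₁ (false, true, false, false, true, false) = c₁ + q₂ + q₄ + s₄)
    (h5 : tcount Z₁ u u' a₁ (true, false, true, true, true, false) = c + c₂ + 4 * f₁ + 4 * f₂ + q₁ + q₂ + s₅)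
    (h6 : tcount Z₁ u u' a₁ (true, true, true, false, true, false) = c + c₁ + 4 * f₁ + f₂ + q₁ + q₃ + s₆)
    (h7 : tcount Z₁ u u' a₁ (true, true, true, true, true, true) = 2 * f₁ + 2 * f₂ + s₀)
    (h8 : tcount Z₁ u u' a₁ (false, false, false, true, false, false) = c₂ + 4 * c₃ + d + q₅ + q₆ + s₇)
    (h9 : tcount Z₁ u u' a₁ (false, true, false, false, false, false) = c₁ + 4 * c₃ + d + q₅ + q₇ + s₈)
    (h10 : tcount Z₁ u u' a₁ (false, false, true, true, false, false) = 2 * c₂ + q₇ + q₈ + s₉)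
    (h11 : tcount Z₁ u u' a₁ (true, true, false, false, false, false) = 2 * c₁ + q₆ + q₈ + s₁₀)
    (h12 : tcount Z₁ u u' a₁ (false, false, false, false, true, true)
      + tcount Z₁ u u' a₁ (false, false, false, false, true, false) = c₃ + d + s₁₁)
    (h13 : tcount Z₁ u u' a₁ (false, false, false, false, true, false)
      + tcount Z₁ u u' a₁ (false, false, false, false, false, false) = 3 * c₃ + d + s₁₂) (w w' : Vec6) :
    blockMap Z₁ (ex2 u u') a₁ (fun b => if b then w' else w) =
      (c : ℝ) • thetaTri w w'
        + (c₁ : ℝ) • thetaTri w (ellv w')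
        + (c₂ : ℝ) • thetaTri (ellv w) w'
        + (c₃ : ℝ) • thetaTri (ellv w) (ellv w')
        + (d : ℝ) • ellv (ellv w * ellv w')
        + (f₁ : ℝ) • thetaD1 w w'
        + (f₂ : ℝ) • thetaD2 w w'
        + (q₁ : ℝ) • RelaxedCores.thetaTriJ w w'
        + (q₂ : ℝ) • RelaxedCores.thetaTriJ2 w w'
        + (q₃ : ℝ) • RelaxedCores.thetaTriJ2 w' w
        + (q₄ : ℝ) • RelaxedCores.thetaTriJ4 w w'
        + (q₅ : ℝ) • RelaxedCores.thetaTriJ5 w w'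
        + (q₆ : ℝ) • RelaxedCores.thetaTriJ6 w w'
        + (q₇ : ℝ) • RelaxedCores.thetaTriJ6 w' w
        + (q₈ : ℝ) • RelaxedCores.thetaTriJ8 w w'
        + (E : ℝ) • apartExcess w w'
        + (s₁ : ℝ) • ellv (w * w')
        + (s₂ : ℝ) • (ellv w * ellv w')
        + (s₃ : ℝ) • ellv (ellv w * w')
        + (s₄ : ℝ) • ellv (w * ellv w')
        + (s₅ : ℝ) • (ellv w * w')
        + (s₆ : ℝ) • (w * ellv w')
        + (s₀ : ℝ) • (w * w')
        + (s₇ : ℝ) • (nAdm w • ellv w')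
        + (s₈ : ℝ) • (nAdm w' • ellv w)
        + (s₉ : ℝ) • (nAdm w • w')
        + (s₁₀ : ℝ) • (nAdm w' • w)
        + (s₁₁ : ℝ) • (nAdm (w * w') • (1 : Vec6))
        + (s₁₂ : ℝ) • ((nAdm w * nAdm w') • (1 : Vec6)) := by
  have hN := blockMap_ex2_eq_normal Z₁ u u' a₁ w w'
  rw [excess, h0, h2, h3, h4] at hN
  have h12' : (tcount Z₁ u u' a₁ (false, false, false, false, true, true) : ℝ)
      + tcount Z₁ u u' a₁ (false, false, false, false, true, false) = ((c₃ + d + s₁₁ : ℕ) : ℝ) := by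
    rw [← Nat.cast_add, h12]
  have h13' : (tcount Z₁ u u' a₁ (false, false, false, false, true, false) : ℝ)
      + tcount Z₁ u u' a₁ (false, false, false, false, false, false) = ((3 * c₃ + d + s₁₂ : ℕ) : ℝ) := by
    rw [← Nat.cast_add, h13]
  rw [hN, h1, h5, h6, h7, h8, h9, h10, h11, h12', h13', thetaD1_eq_excess, thetaD2_eq_excess, thetaTri_eq_apartExcess,
    thetaTri_w_ellv, thetaTri_ellv_w, thetaTri_ellv_ellv, ellv_ellv_mul_ellv]
  simp only [RelaxedCores.thetaTriJ, RelaxedCores.thetaTriJ2, RelaxedCores.thetaTriJ4, RelaxedCores.thetaTriJ5,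
    RelaxedCores.thetaTriJ6, RelaxedCores.thetaTriJ8, apartExcess, thetaTri_eq_apartExcess]
  push_cast
  ext i
  simp only [Pi.add_apply, Pi.sub_apply, Pi.smul_apply, Pi.mul_apply, smul_eq_mul]
  ring

/-- **(P) AT A HOST WHOSE EXCESS IS ABSORBED BY TRIANGLES, STAR TREES, DIAMONDS AND THE MIXED COMPLETIONS, WITH TWO CONE ZONES.** -/
theorem K4v_blockMap_ex2_of_absorbQ (c c₁ c₂ c₃ d f₁ f₂ q₁ q₂ q₃ q₄ q₅ q₆ q₇ q₈ s₁ s₂ s₃ s₄ s₅ s₆ s₀ s₇ s₈ s₉ s₁₀ s₁₁ s₁₂ : ℕ)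
    (h0 : tcount Z₁ u u' a₁ (false, true, false, true, false, true) =
      c + c₁ + c₂ + 2 * c₃ + d + 2 * f₁ + 2 * f₂ + q₁ + q₂ + q₃ + q₄ + q₅ + q₆ + q₇ + q₈ + 0 + tcount Z₁ u u' a₁ (false, true, true, false, false, false)
        + tcount Z₁ u u' a₁ (false, false, false, true, true, false)
        + tcount Z₁ u u' a₁ (false, true, false, false, true, false))
    (h1 : tcount Z₁ u u' a₁ (false, true, false, true, true, true) = c + f₁ + 4 * f₂ + s₁)
    (h2 : tcount Z₁ u u' a₁ (false, true, true, false, false, false) = c₁ + c₂ + 2 * c₃ + 2 * f₁ + s₂)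
    (h3 : tcount Z₁ u u' a₁ (false, false, false, true, true, false) = c₂ + 2 * f₂ + q₃ + q₄ + s₃)
    (h4 : tcount Z₁ u u' a₁ (false, true, false, false, true, false) = c₁ + q₂ + q₄ + s₄)
    (h5 : tcount Z₁ u u' a₁ (true, false, true, true, true, false) = c + c₂ + 4 * f₁ + 4 * f₂ + q₁ + q₂ + s₅)
    (h6 : tcount Z₁ u u' a₁ (true, true, true, false, true, false) = c + c₁ + 4 * f₁ + f₂ + q₁ + q₃ + s₆)
    (h7 : tcount Z₁ u u' a₁ (true, true, true, true, true, true) = 2 * f₁ + 2 * f₂ + s₀)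
    (h8 : tcount Z₁ u u' a₁ (false, false, false, true, false, false) = c₂ + 4 * c₃ + d + q₅ + q₆ + s₇)
    (h9 : tcount Z₁ u u' a₁ (false, true, false, false, false, false) = c₁ + 4 * c₃ + d + q₅ + q₇ + s₈)
    (h10 : tcount Z₁ u u' a₁ (false, false, true, true, false, false) = 2 * c₂ + q₇ + q₈ + s₉)
    (h11 : tcount Z₁ u u' a₁ (true, true, false, false, false, false) = 2 * c₁ + q₆ + q₈ + s₁₀)
    (h12 : tcount Z₁ u u' a₁ (false, false, false, false, true, true)
      + tcount Z₁ u u' a₁ (false, false, false, false, true, false) = c₃ + d + s₁₁)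
    (h13 : tcount Z₁ u u' a₁ (false, false, false, false, true, false)
      + tcount Z₁ u u' a₁ (false, false, false, false, false, false) = 3 * c₃ + d + s₁₂)
    {w w' : Vec6} (hw : InCone w) (hw' : InCone w') :
    K4v (blockMap Z₁ (ex2 u u') a₁ (fun b => if b then w' else w)) := by
  rw [blockMap_ex2_eq_absorbQ Z₁ u u' a₁ c c₁ c₂ c₃ d f₁ f₂ q₁ q₂ q₃ q₄ q₅ q₆ q₇ q₈ s₁ s₂ s₃ s₄ s₅ s₆ s₀ s₇ s₈ s₉ s₁₀ s₁₁ s₁₂ 0 h0 h1 h2 h3 h4 h5 h6 h7 h8 h9 h10 h11 h12 h13]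
  obtain ⟨m1, m2, m3, m4, m5, m6, m7, m8, m9, m10, m11, m12, m13⟩ := InCone_manifest hw hw'
  have hl := inCone_ellv hw
  have hl' := inCone_ellv hw'
  have hKD1 : K4v (thetaD1 w w') := RelaxedCores.K4v_thetaD1_of_inCone hw hw'
  generalize thetaD1 w w' = XD1 at hKD1 ⊢
  have hKD2 : K4v (thetaD2 w w') := RelaxedCores.K4v_thetaD2_of_inCone hw hw'
  generalize thetaD2 w w' = XD2 at hKD2 ⊢
  have hKJ1 : K4v (RelaxedCores.thetaTriJ w w') := RelaxedCores.K4v_thetaTriJ_of_inCone hw hw'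
  generalize RelaxedCores.thetaTriJ w w' = XJ1 at hKJ1 ⊢
  have hKJ2 : K4v (RelaxedCores.thetaTriJ2 w w') := RelaxedCores.K4v_thetaTriJ2_of_inCone hw hw'
  generalize RelaxedCores.thetaTriJ2 w w' = XJ2 at hKJ2 ⊢
  have hKJ3 : K4v (RelaxedCores.thetaTriJ2 w' w) := RelaxedCores.K4v_thetaTriJ2_of_inCone hw' hw
  generalize RelaxedCores.thetaTriJ2 w' w = XJ3 at hKJ3 ⊢
  have hKJ4 : K4v (RelaxedCores.thetaTriJ4 w w') := RelaxedCores.K4v_thetaTriJ4_of_inCone hw hw'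
  generalize RelaxedCores.thetaTriJ4 w w' = XJ4 at hKJ4 ⊢
  have hKJ5 : K4v (RelaxedCores.thetaTriJ5 w w') := RelaxedCores.K4v_thetaTriJ5_of_inCone hw hw'
  generalize RelaxedCores.thetaTriJ5 w w' = XJ5 at hKJ5 ⊢
  have hKJ6 : K4v (RelaxedCores.thetaTriJ6 w w') := RelaxedCores.K4v_thetaTriJ6_of_inCone hw hw'
  generalize RelaxedCores.thetaTriJ6 w w' = XJ6 at hKJ6 ⊢
  have hKJ7 : K4v (RelaxedCores.thetaTriJ6 w' w) := RelaxedCores.K4v_thetaTriJ6_of_inCone hw' hw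
  generalize RelaxedCores.thetaTriJ6 w' w = XJ7 at hKJ7 ⊢
  have hKJ8 : K4v (RelaxedCores.thetaTriJ8 w w') := RelaxedCores.K4v_thetaTriJ8_of_inCone hw hw'
  generalize RelaxedCores.thetaTriJ8 w w' = XJ8 at hKJ8 ⊢
  simp only [Nat.cast_zero, zero_smul, add_zero]
  repeat' apply K4v_add
  all_goals refine K4v_smul ?_ (by positivity)
  all_goals first
    | exact hKD1
    | exact hKD2
    | exact hKJ1
    | exact hKJ2
    | exact hKJ3
    | exact hKJ4
    | exact hKJ5
    | exact hKJ6
    | exact hKJ7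
    | exact hKJ8
    | exact K4v_thetaTri_of_InCone hw hw'
    | exact K4v_thetaTri_of_InCone hw hl'
    | exact K4v_thetaTri_of_InCone hl hw'
    | exact K4v_thetaTri_of_InCone hl hl'
    | exact K4v_of_InCone (inCone_ellv (hl.mul hl'))
    | exact K4v_of_InCone m1
    | exact K4v_of_InCone m2
    | exact K4v_of_InCone m3
    | exact K4v_of_InCone m4
    | exact K4v_of_InCone m5
    | exact K4v_of_InCone m6
    | exact K4v_of_InCone m7
    | exact K4v_of_InCone m8
    | exact K4v_of_InCone m9
    | exact K4v_of_InCone m10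
    | exact K4v_of_InCone m11
    | exact K4v_of_InCone m12
    | exact K4v_of_InCone m13

/-- The ZONE O-CUBE at a host whose excess is absorbed by triangles, star trees, diamonds and the mixed completions, with two
cone zones: `2F ≤ T₁ + T₂ + 2I`. -/
theorem zoneOCube_blockMap_ex2_of_absorbQ (c c₁ c₂ c₃ d f₁ f₂ q₁ q₂ q₃ q₄ q₅ q₆ q₇ q₈ s₁ s₂ s₃ s₄ s₅ s₆ s₀ s₇ s₈ s₉ s₁₀ s₁₁ s₁₂ : ℕ)
    (h0 : tcount Z₁ u u' a₁ (false, true, false, true, false, true) =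
      c + c₁ + c₂ + 2 * c₃ + d + 2 * f₁ + 2 * f₂ + q₁ + q₂ + q₃ + q₄ + q₅ + q₆ + q₇ + q₈ + 0 + tcount Z₁ u u' a₁ (false, true, true, false, false, false)
        + tcount Z₁ u u' a₁ (false, false, false, true, true, false)
        + tcount Z₁ u u' a₁ (false, true, false, false, true, false))
    (h1 : tcount Z₁ u u' a₁ (false, true, false, true, true, true) = c + f₁ + 4 * f₂ + s₁)
    (h2 : tcount Z₁ u u' a₁ (false, true, true, false, false, false) = c₁ + c₂ + 2 * c₃ + 2 * f₁ + s₂)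
    (h3 : tcount Z₁ u u' a₁ (false, false, false, true, true, false) = c₂ + 2 * f₂ + q₃ + q₄ + s₃)
    (h4 : tcount Z₁ u u' a₁ (false, true, false, false, true, false) = c₁ + q₂ + q₄ + s₄)
    (h5 : tcount Z₁ u u' a₁ (true, false, true, true, true, false) = c + c₂ + 4 * f₁ + 4 * f₂ + q₁ + q₂ + s₅)
    (h6 : tcount Z₁ u u' a₁ (true, true, true, false, true, false) = c + c₁ + 4 * f₁ + f₂ + q₁ + q₃ + s₆)
    (h7 : tcount Z₁ u u' a₁ (true, true, true, true, true, true) = 2 * f₁ + 2 * f₂ + s₀)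
    (h8 : tcount Z₁ u u' a₁ (false, false, false, true, false, false) = c₂ + 4 * c₃ + d + q₅ + q₆ + s₇)
    (h9 : tcount Z₁ u u' a₁ (false, true, false, false, false, false) = c₁ + 4 * c₃ + d + q₅ + q₇ + s₈)
    (h10 : tcount Z₁ u u' a₁ (false, false, true, true, false, false) = 2 * c₂ + q₇ + q₈ + s₉)
    (h11 : tcount Z₁ u u' a₁ (true, true, false, false, false, false) = 2 * c₁ + q₆ + q₈ + s₁₀)
    (h12 : tcount Z₁ u u' a₁ (false, false, false, false, true, true)
      + tcount Z₁ u u' a₁ (false, false, false, false, true, false) = c₃ + d + s₁₁)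
    (h13 : tcount Z₁ u u' a₁ (false, false, false, false, true, false)
      + tcount Z₁ u u' a₁ (false, false, false, false, false, false) = 3 * c₃ + d + s₁₂)
    {w w' : Vec6} (hw : InCone w) (hw' : InCone w') :
    0 ≤ (blockMap Z₁ (ex2 u u') a₁ (fun b => if b then w' else w) 1
          - blockMap Z₁ (ex2 u u') a₁ (fun b => if b then w' else w) 0)
        + (blockMap Z₁ (ex2 u u') a₁ (fun b => if b then w' else w) 2
          - blockMap Z₁ (ex2 u u') a₁ (fun b => if b then w' else w) 0)
        + 2 * (blockMap Z₁ (ex2 u u') a₁ (fun b => if b then w' else w) 4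
          + blockMap Z₁ (ex2 u u') a₁ (fun b => if b then w' else w) 5
          - blockMap Z₁ (ex2 u u') a₁ (fun b => if b then w' else w) 3)
        - 2 * blockMap Z₁ (ex2 u u') a₁ (fun b => if b then w' else w) 0 :=
  zoneOCube_nonneg_of_K4 (K4v_blockMap_ex2_of_absorbQ Z₁ u u' a₁ c c₁ c₂ c₃ d f₁ f₂ q₁ q₂ q₃ q₄ q₅ q₆ q₇ q₈ s₁ s₂ s₃ s₄ s₅ s₆ s₀ s₇ s₈ s₉ s₁₀ s₁₁ s₁₂ h0 h1 h2 h3 h4 h5 h6 h7 h8 h9 h10 h11 h12 h13 hw hw')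

end MultiExit

end ZoneZ

end PercRepro
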